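import Literature.NumberTheory.Transcendental.PkappaThetaAdditionPoly
import HarnessLib

/-!
# A finite complete family of analytic addition laws on `M_κ`

Topic `Literature/NumberTheory/Transcendental`. A brick for the theta-model instance of the
abstract zero estimate (`ZeroEstModel.lean`, field `exists_lam_ne_zero`): the analytic addition
laws `lawPoly L κM s v` of `PkappaThetaAdditionPoly.lean` have units `lawUnit L s u v`, non-zero
iff no `E`-coordinate of `u + s` or of `u - v - 2s` is a lattice point (`lawUnit_ne_zero_iff`).
We exhibit FINITELY many auxiliary points `s_0, …, s_{2|γ|}` such that for every pair `(u, v)`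
some `lawUnit L s_α u v ≠ 0` (`exists_lawUnit_auxPt_ne_zero`): with `τ = ω₁ / (4|γ| + 3)` no
non-zero multiple `k τ`, `|k| ≤ 4|γ| + 2`, is a period (`intCast_mul_genericShift_notMem`), the
points `s_α = ((α + 1) τ` on every `E`-coordinate`)` are pairwise incongruent together with their
doubles, so each `E`-coordinate `b` excludes at most one `α` through `u_b + s_{α,b} ∈ Λ` and at
most one through `u_b - v_b - 2 s_{α,b} ∈ Λ`; `2|γ| + 1` indices suffice. Everything is PROVED.

## References

* D. Masser, G. Wüstholz, *Zero estimates on group varieties I*, Invent. Math. 64 (1981),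
  489–516, §2 (complete systems of addition laws). [MasserWustholz1981]
* S. Lang, *Elliptic curves: Diophantine analysis*, Springer 1978, Ch. I §2 (σ-function addition
  formula). [Lang1978]
-/

noncomputable section

open Complex

namespace Literature.NumberTheory.Transcendental

namespace GaGmE

namespace Std

variable {β γ δ : Type} [Fintype β] [Fintype γ] [Fintype δ] [DecidableEq γ]
variable (L : PeriodPair)

/-! ### A generic shift -/

/-- `τ_m = ω₁ / (m + 1)`. [folklore] -/
def genericShift (m : ℕ) : ℂ := L.ω₁ / ((m : ℂ) + 1)

/-- **No non-zero multiple `k τ_m` with `|k| ≤ m` is a period.** [folklore] -/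
theorem intCast_mul_genericShift_notMem (m : ℕ) {k : ℤ} (hk0 : k ≠ 0) (hk : |k| ≤ m) :
    (k : ℂ) * genericShift L m ∉ L.lattice := by
  intro hmem
  rw [PeriodPair.lattice, Submodule.mem_span_pair] at hmem
  obtain ⟨a, b, hab⟩ := hmem
  -- `(k/(m+1) - a) ω₁ - b ω₂ = 0` over `ℝ`
  have hm : ((m : ℂ) + 1) ≠ 0 := by exact_mod_cast Nat.succ_ne_zero m
  have hind := LinearIndependent.pair_iff.mp L.indep ((k : ℝ) / ((m : ℝ) + 1) - a) (-(b : ℝ)) (by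
    have h1 : ((k : ℝ) / ((m : ℝ) + 1) - a : ℝ) • L.ω₁ + (-(b : ℝ)) • L.ω₂ =
        ((k : ℂ) / ((m : ℂ) + 1)) * L.ω₁ - ((a : ℂ) * L.ω₁ + (b : ℂ) * L.ω₂) := by
      simp only [Complex.real_smul]; push_cast; ring
    rw [h1]
    have h2 : (a : ℂ) * L.ω₁ + (b : ℂ) * L.ω₂ = a • L.ω₁ + b • L.ω₂ := by simp [zsmul_eq_mul]
    rw [h2, hab, genericShift]
    field_simp
    ring)
  obtain ⟨h1, -⟩ := hind
  -- `k = a (m+1)`, contradicting `0 < |k| ≤ m`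
  have hk' : (k : ℝ) = a * ((m : ℝ) + 1) := by
    have hm' : ((m : ℝ) + 1) ≠ 0 := by positivity
    field_simp at h1
    linarith
  have hkz : k = a * (m + 1) := by exact_mod_cast hk'
  rcases eq_or_ne a 0 with ha | ha
  · exact hk0 (by rw [hkz, ha, zero_mul])
  · have : (m : ℤ) + 1 ≤ |k| := by
      rw [hkz, abs_mul, show |((m : ℤ) + 1)| = (m : ℤ) + 1 from abs_of_nonneg (by positivity)]
      have : 1 ≤ |a| := Int.one_le_abs ha
      nlinarith
    omega

/-! ### The auxiliary points -/

/-- The auxiliary points `s_α`: `(α + 1) τ` on every `E`-coordinate, `0` elsewhere, with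
`τ = τ_{4|γ|+2}`. [folklore] -/
def auxPt (α : ℕ) : β ⊕ (γ ⊕ δ) → ℂ := fun i =>
  match i with
  | Sum.inr (Sum.inl _) => ((α : ℂ) + 1) * genericShift L (4 * Fintype.card γ + 2)
  | _ => 0

omit [Fintype β] [Fintype δ] [DecidableEq γ] in
/-- The `E`-coordinates of the auxiliary points. [folklore] -/
@[simp] theorem auxPt_iz (α : ℕ) (b : γ) :
    auxPt (β := β) (δ := δ) L α (iz b) = ((α : ℂ) + 1) * genericShift L (4 * Fintype.card γ + 2) := rfl

omit [Fintype β] [Fintype δ] [DecidableEq γ] in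
/-- Differences of the `E`-coordinates of distinct auxiliary points (and their doubles) are not
periods, for indices `< 2|γ| + 1`. [folklore] -/
theorem auxPt_sub_notMem {α α' : ℕ} (hα : α < 2 * Fintype.card γ + 1) (hα' : α' < 2 * Fintype.card γ + 1)
    (hne : α ≠ α') (b : γ) (e : ℕ) (he : e = 1 ∨ e = 2) :
    (e : ℂ) * (auxPt (β := β) (δ := δ) L α (iz b) - auxPt (β := β) (δ := δ) L α' (iz b)) ∉ L.lattice := by
  rw [auxPt_iz, auxPt_iz, ← sub_mul, ← mul_assoc]
  have : (e : ℂ) * ((α : ℂ) + 1 - ((α' : ℂ) + 1)) = ((e * ((α : ℤ) - α') : ℤ) : ℂ) := by push_cast; ring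
  rw [this]
  refine intCast_mul_genericShift_notMem L _ ?_ ?_
  · have h : (α : ℤ) - α' ≠ 0 := sub_ne_zero.mpr (by exact_mod_cast hne)
    rcases he with rfl | rfl
    · simpa using h
    · exact mul_ne_zero (by norm_num) h
  · have h : |(α : ℤ) - α'| ≤ 2 * Fintype.card γ := by
      rw [abs_sub_le_iff]; constructor <;> omega
    rcases he with rfl | rfl
    · rw [Nat.cast_one, one_mul]; push_cast; omega
    · rw [abs_mul, Nat.cast_ofNat, abs_two]; push_cast; omega

omit [Fintype β] [Fintype δ] [DecidableEq γ] in
/-- **Completeness of the family**: for every `(u, v)` some `lawUnit L s_α u v ≠ 0`, `α ≤ 2|γ|`.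
[cite: MasserWustholz1981, §2 (complete system of addition laws)] -/
theorem exists_lawUnit_auxPt_ne_zero (u v : β ⊕ (γ ⊕ δ) → ℂ) :
    ∃ α : Fin (2 * Fintype.card γ + 1), lawUnit (β := β) (δ := δ) L (auxPt L α) u v ≠ 0 := by
  classical
  -- bad indices: for each `b`, at most one `α` with `u_b + s_{α,b} ∈ Λ`, at most one with
  -- `u_b - v_b - 2 s_{α,b} ∈ Λ`
  set n := Fintype.card γ with hn
  let bad₁ : γ → Finset (Fin (2 * n + 1)) := fun b =>
    Finset.univ.filter fun α => u (iz b) + auxPt (β := β) (δ := δ) L α (iz b) ∈ L.lattice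
  let bad₂ : γ → Finset (Fin (2 * n + 1)) := fun b =>
    Finset.univ.filter fun α => u (iz b) - auxPt (β := β) (δ := δ) L α (iz b) -
      (v (iz b) + auxPt (β := β) (δ := δ) L α (iz b)) ∈ L.lattice
  have hcard₁ : ∀ b, (bad₁ b).card ≤ 1 := fun b => by
    refine Finset.card_le_one.mpr fun α hα α' hα' => ?_
    by_contra hne
    simp only [bad₁, Finset.mem_filter, Finset.mem_univ, true_and] at hα hα'
    have hsub := L.lattice.sub_mem hα hα'
    have : u (iz b) + auxPt (β := β) (δ := δ) L α (iz b) - (u (iz b) + auxPt (β := β) (δ := δ) L α' (iz b)) =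
        (1 : ℕ) * (auxPt (β := β) (δ := δ) L α (iz b) - auxPt (β := β) (δ := δ) L α' (iz b)) := by push_cast; ring
    rw [this] at hsub
    exact auxPt_sub_notMem L α.2 α'.2 (fun h => hne (Fin.ext h)) b 1 (Or.inl rfl) hsub
  have hcard₂ : ∀ b, (bad₂ b).card ≤ 1 := fun b => by
    refine Finset.card_le_one.mpr fun α hα α' hα' => ?_
    by_contra hne
    simp only [bad₂, Finset.mem_filter, Finset.mem_univ, true_and] at hα hα'
    have hsub := L.lattice.sub_mem hα' hα
    have : u (iz b) - auxPt (β := β) (δ := δ) L α' (iz b) - (v (iz b) + auxPt (β := β) (δ := δ) L α' (iz b)) -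
        (u (iz b) - auxPt (β := β) (δ := δ) L α (iz b) - (v (iz b) + auxPt (β := β) (δ := δ) L α (iz b))) =
        (2 : ℕ) * (auxPt (β := β) (δ := δ) L α (iz b) - auxPt (β := β) (δ := δ) L α' (iz b)) := by push_cast; ring
    rw [this] at hsub
    exact auxPt_sub_notMem L α.2 α'.2 (fun h => hne (Fin.ext h)) b 2 (Or.inr rfl) hsub
  -- the union of the bad sets has `≤ 2n < 2n + 1` elements
  set bad : Finset (Fin (2 * n + 1)) := Finset.univ.biUnion fun b => bad₁ b ∪ bad₂ b with hbad
  have hbadcard : bad.card ≤ 2 * n := by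
    calc bad.card ≤ ∑ b, (bad₁ b ∪ bad₂ b).card := Finset.card_biUnion_le
      _ ≤ ∑ _b : γ, 2 := Finset.sum_le_sum fun b _ => (Finset.card_union_le _ _).trans (by have := hcard₁ b; have := hcard₂ b; omega)
      _ = 2 * n := by simp [hn, mul_comm]
  have hlt : bad.card < (Finset.univ : Finset (Fin (2 * n + 1))).card := by
    rw [Finset.card_univ, Fintype.card_fin]; omega
  obtain ⟨α, -, hα⟩ := Finset.exists_mem_notMem_of_card_lt_card hlt
  refine ⟨α, (lawUnit_ne_zero_iff L _ u v).mpr ⟨fun b hb => hα ?_, fun b hb => hα ?_⟩⟩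
  · rw [hbad, Finset.mem_biUnion]
    exact ⟨b, Finset.mem_univ b, Finset.mem_union_left _ (by simpa [bad₁] using hb)⟩
  · rw [hbad, Finset.mem_biUnion]
    exact ⟨b, Finset.mem_univ b, Finset.mem_union_right _ (by simpa [bad₂] using hb)⟩

end Std

end GaGmE

end Literature.NumberTheory.Transcendental
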